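import Summits.ResolutionOfSingularities.ResolutionOfSingularities.Theorems.FrobeniusClosingSteerArithTransportTyping
import Summits.ResolutionOfSingularities.ResolutionOfSingularities.Theorems.FrobeniusClosingSteerArithTransportSatelliteWord
import Summits.ResolutionOfSingularities.ResolutionOfSingularities.Theorems.FrobeniusClosingSteerEventuallyOnlyExcStrips
import Summits.ResolutionOfSingularities.ResolutionOfSingularities.Theorems.FrobeniusClosingSteerArithRunHygieneHolds
import HarnessLib

/-!
# Crux `Steer` (stmt-ResolutionOfSingularities-16345), chain W4.1, β-leaf K-β0(b) — THE VISIT INDUCTION `arithTransport_of_words`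
# (res-L0-w41-plan-1 RULING 299(b)/(c); seat res-L0-w41-stub-3 g8; words res-L0-w41-strat-2 g4 `…ArithTransportWords` p571472)

OURS (campaign `res-hironaka`, rung L ★L-G4, slot W4.1). Candidates, not facts; nothing here is a statement of H. Hironaka's manuscript
[Hironaka2017] (status: under review). AI-written; AI review is weaker than expert review. Theses-free, definition-free.

THE THEOREM. `arithTransport_of_words : (F-AB) → (F-BB) → (T-R) → (P-AB) → (P-BB) → (P-BA) → (S-BB) → hS1b → «ArithTransportTwoN re-typed»`:
the β-leaf's K-β0(b) word `ArithTransportTwoN` (idea-1 leaf v18.4, l.769) with `d` bound under `Odd d → 3 ≤ d →` (RULING 299(c)), the K-β0(a)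
conclusion «late odd-cleaned point steps carry an `e = 2` binary cone of degree `d`» as a hypothesis (`BinaryConeAt` unfolded as
`IsPointStep ∧ BinaryConeE2At`), and W30's `Words.` copies of `ArithSwitchClause` / `OddCleanedPointStepAt` / `ArithBinaryResidueAt`.

THE PROOF (strat-2's «NOT DONE HERE» paragraph, made precise). Run plumbing as in `ArithLeaf.oddArith_of_words`: hygiene
(`ArithLeaf.arithRunHygieneTwoN_holds`), the `hodd` binder FROM THE SWITCH CLAUSE (`oddCleanedPointStepAt_of_arithBinaryResidueAt`), strips
(`ArithLeaf.eventuallyOnlyExcStripsTwoN_holds`), hS1b (reduced order `d₀` at late point steps). At the given late `i ≤ i′`: the `e = 2` cone at `i`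
fixes the cleaned order `d`, so `d = d₀` and `i` is an A-stage (`eq_and_noOddDivisorAt_of_hasReducedOrderAt`); the anisotropic cone at `i′` makes
`i′` an A-stage too. DESCENDING INDUCTION over the point steps `j ∈ [i, i′]` (`desc_pointSteps_of_visitPairs`) of
`Q j := (A-stage ∧ e=2 cone ⇒ anisotropic cone) ∧ (∀ x, B-stage along x ∧ e=2 B-shape along x ⇒ anisotropic B-shape along x)`:
at a visit pair `(j, j′)` with exceptional parameter `u` of the step `j` (the run's strict-step clause), `VisitLawDelta.visitLaw₂_of_run` types the
landing stage — after an A-stage `u` is odd at `j′` (clord `d % 2 = 1`, `VisitLawPointStep.prime_excParam_succ`), so `j′` is a B-stage of cleaned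
order `d + 1` and (F-AB) + `Q j′` + (P-AB) give the A-part of `Q j`; at a B-stage along `x` (`x ∈ P j`, so `v x ≤ v u`): if `v x < v u`, (S-BB) makes
`x/u` the odd divisor at `j′`, cleaned order `d + 1`, and (F-BB) + `Q j′` + (P-BB) conclude; if `v x = v u`, `x` is itself exceptional, (T-R) makes `j′`
an A-stage of order `d`, the K-β0(a) hypothesis re-supplies its `e = 2` cone, and `Q j′` + (P-BA) conclude. Finally `Q i` at the A-stage `i`.
USED binders: core hR0 hN hrun hnd hhigh h2inf hinf hwild hnp hASC (all feed HΓ / hS1b); UNUSED: none.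
-/

-- `Summit.<S>.<S>.…` duplicates the summit name by design (single-problem summit).
set_option linter.dupNamespace false

open IsLocalRing
open Literature.AlgebraicGeometry.Resolution
open Summit.ResolutionOfSingularities.ResolutionOfSingularities.Theorems.SwitchingDichotomy.Words
open Summit.ResolutionOfSingularities.ResolutionOfSingularities.Theorems.SteerRankThinness (Concl HasProperCoarsening)
open Summit.ResolutionOfSingularities.ResolutionOfSingularities.Theorems.SwitchingDichotomy

namespace Summit.ResolutionOfSingularities.ResolutionOfSingularities.Theorems.SwitchingDichotomy.ArithTransport

/-- **THE VISIT INDUCTION (K-β0(b) from the seven visit words and hS1b).** See the module docstring for the statement's provenance and the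
proof. OURS. (folklore) -/
theorem arithTransport_of_words (hFAB : BinaryBConeAfterATwoN) (hFBB : BinaryBConeAfterBTwoN) (hTR : ReturnIsAStageTwoN)
    (hPAB : AnisotropyPullbackABTwoN) (hPBB : AnisotropyPullbackBBTwoN) (hPBA : AnisotropyPullbackBATwoN)
    (hSBB : OddSatelliteSurvivesTwoN) (hS1b : ArithLeaf.EventuallyConstantReducedOrderTwoN) :
    ∀ p : ℕ, p = 2 →
    ∀ (k K : Type) [Field k] [CharP k p] [PerfectField k] [Field K] [Algebra k K]
    (O : ValuationSubring K) (A₀ : Subalgebra k K) (h₀ : A₀.toSubring ≤ O.toSubring) (t : K),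
    CoreDatum p 4 k K O A₀ h₀ t → ¬ HasProperCoarsening O →
    ∀ (R : ℕ → Subring K) (P : (i : ℕ) → Ideal (R i)) (s : ℕ → K),
      R 0 = locAtCentre A₀.toSubring O → NormalAt O (R 0) p t → IsSteeredRun O R P t p s →
      (¬ ∃ i₀ c : ℕ, 1 ≤ c ∧ IsDominantTail R P i₀ c) →
      (∃ i₀ : ℕ, ∀ i, i₀ ≤ i → IsHighOrderAt R s p i) →
      ¬ HeightTwoStepsInfinite R P → {j | IsPosStep R P j}.Infinite →
      (∀ i₀ : ℕ, ∃ i, i₀ ≤ i ∧ IsPointStep R P i ∧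
        ∀ hs : s i ^ p ∈ R i, ¬ HasIsolatedSingularity (RadicandRing (R i) p ⟨s i ^ p, hs⟩)) →
      (¬ ∃ i₀ : ℕ, ∃ x : K, x ≠ 0 ∧ x ∈ O ∧ O.valuation x < 1 ∧
        ∀ i, i₀ ≤ i → ∀ y ∈ R i, O.valuation y < 1 → ∃ j, i < j ∧ y / x ∈ R j) →
      Words.ArithSwitchClause R P s p →
      ∀ d : ℕ, Odd d → 3 ≤ d →
        (∃ i₀ : ℕ, ∀ i, i₀ ≤ i → Words.OddCleanedPointStepAt R P s p i → IsPointStep R P i ∧ BinaryConeE2At R s p d i) →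
        ∃ i₀ : ℕ, ∀ i i' : ℕ, i₀ ≤ i → i ≤ i' → Words.OddCleanedPointStepAt R P s p i → IsPointStep R P i ∧ BinaryConeE2At R s p d i →
          Words.ArithBinaryResidueAt R P s p d i' → Words.ArithBinaryResidueAt R P s p d i := by
  intro p hp2 k K _ _ _ _ _ O A₀ h₀ t core hrk R P s hR0 hN hrun hnd hhigh h2inf hinf hwild hnp hASC d hd h3 hTC
  subst hp2
  classical
  haveI : CharP K 2 := charP_of_injective_algebraMap (algebraMap k K).injective 2
  -- ### (0) the run's clauses: local members, blow-ups, exceptional parameters, domination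
  haveI hRloc : ∀ i, IsLocalRing (R i) := fun i => (hrun.2 i).1
  have hbl : ∀ i, IsLocalBlowupAlong O (R i) (P i) (R (i + 1)) := fun i => (hrun.2 i).2.2.2.1
  have hst : ∀ i, ∃ x g : K, ((∃ hx : x ∈ R i, (⟨x, hx⟩ : R i) ∈ P i) ∧ x ≠ 0 ∧
      ∀ y : R i, y ∈ P i → O.valuation (y : K) ≤ O.valuation x) ∧ g ∈ R i ∧ s i = x * s (i + 1) + g :=
    fun i => (hrun.2 i).2.2.2.2
  choose xx gg hxg using hst
  have hxx : ∀ i, (∃ hx : xx i ∈ R i, (⟨xx i, hx⟩ : R i) ∈ P i) ∧ xx i ≠ 0 ∧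
      ∀ y : R i, y ∈ P i → O.valuation (y : K) ≤ O.valuation (xx i) := fun i => (hxg i).1
  have hdom0 : SubringDominates (R 0) O.toSubring := by
    rw [hR0]
    exact subringDominates_locAtCentre h₀
  -- ### (1) hygiene (HYG, tree)
  obtain ⟨N₄, hreg, hdim, h0, h1⟩ := ArithLeaf.arithRunHygieneTwoN_holds 2 rfl k K O A₀ h₀ t core hrk R P s hR0 hN hrun
  -- ### (2) `hodd` from the switch clause (the β-leaf's K-β0 words carry `ArithSwitchClause`, the hARᵒ words want `hodd`)
  have hodd : ∀ i₀ : ℕ, ∃ i, i₀ ≤ i ∧ Words.OddCleanedPointStepAt R P s 2 i := by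
    obtain ⟨d', hd', -, hio⟩ := hASC
    intro i₀
    obtain ⟨i, hi, hA⟩ := hio i₀
    exact ⟨i, hi, oddCleanedPointStepAt_of_arithBinaryResidueAt (hreg i) hd' hA⟩
  have hrec : ∀ i₀ : ℕ, ∃ i, i₀ ≤ i ∧ IsPointStep R P i := fun i₀ => by
    obtain ⟨i, hi, hO⟩ := hodd i₀
    exact ⟨i, hi, hO.1⟩
  -- ### (3) high order, strips (HΓ, tree) beyond a common bound `N₂`
  obtain ⟨iₕ, hhi⟩ := hhigh
  have h0' : ∀ j, max N₄ iₕ ≤ j → IsPointStep R P j → ∀ (hs' : s j ^ 2 ∈ R j) (Q : Ideal (R j)) [Q.IsPrime],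
      Q.height = 0 → ¬ SigmaTopLegality.IsSingPrime (R j) 2 ⟨s j ^ 2, hs'⟩ Q :=
    fun j hj => h0 j (le_of_max_le_left hj)
  have h1' : ∀ j, max N₄ iₕ ≤ j → IsPointStep R P j → ∀ (hs' : s j ^ 2 ∈ R j) (Q : Ideal (R j)) [Q.IsPrime],
      Q.height = 1 → ¬ SigmaTopLegality.IsSingPrime (R j) 2 ⟨s j ^ 2, hs'⟩ Q :=
    fun j hj => h1 j (le_of_max_le_left hj)
  obtain ⟨N₂', hΓ'⟩ := ArithLeaf.eventuallyOnlyExcStripsTwoN_holds 2 rfl k K O A₀ h₀ t core hrk R P s hR0 hN hrun hnd ⟨iₕ, hhi⟩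
    h2inf hinf hwild hnp hodd hreg hdim (max N₄ iₕ) h0' h1'
  set N₂ := max (max N₄ iₕ) N₂' with hN₂
  have hΓ : ∀ (j j' : ℕ) (x : K), N₂ ≤ j → IsVisitPair R P j j' →
      ((∃ h : x ∈ R j, (⟨x, h⟩ : R j) ∈ P j) ∧ x ≠ 0 ∧ ∀ y : R j, y ∈ P j → O.valuation (y : K) ≤ O.valuation x) →
      ∀ l, j < l → l < j' → ∃ hx : x ∈ R l, P l = Ideal.span {(⟨x, hx⟩ : R l)} :=
    fun j j' x hj => hΓ' j j' x (le_of_max_le_right hj)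
  have h0'' : ∀ j, N₂ ≤ j → IsPointStep R P j → ∀ (hs' : s j ^ 2 ∈ R j) (Q : Ideal (R j)) [Q.IsPrime],
      Q.height = 0 → ¬ SigmaTopLegality.IsSingPrime (R j) 2 ⟨s j ^ 2, hs'⟩ Q :=
    fun j hj => h0' j (le_of_max_le_left hj)
  have h1'' : ∀ j, N₂ ≤ j → IsPointStep R P j → ∀ (hs' : s j ^ 2 ∈ R j) (Q : Ideal (R j)) [Q.IsPrime],
      Q.height = 1 → ¬ SigmaTopLegality.IsSingPrime (R j) 2 ⟨s j ^ 2, hs'⟩ Q :=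
    fun j hj => h1' j (le_of_max_le_left hj)
  -- ### (4) hS1b: the odd reduced order `d₀` at late point steps
  obtain ⟨d₀, i₁, hd₀, -, hred, -⟩ := hS1b 2 rfl k K O A₀ h₀ t core hrk R P s hR0 hN hrun hnd ⟨iₕ, hhi⟩ h2inf hinf hwild hnp
    hodd hreg hdim N₂ h0'' h1'' hΓ
  -- ### (5) the K-β0(a) bound; the common bound
  obtain ⟨i₂, hTC⟩ := hTC
  refine ⟨max (max N₂ i₁) i₂, ?_⟩
  intro i i' hi hii' _hOi hBi hAi'
  have hN₂i : N₂ ≤ i := le_of_max_le_left (le_of_max_le_left hi)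
  have hi₁i : i₁ ≤ i := le_of_max_le_right (le_of_max_le_left hi)
  have hi₂i : i₂ ≤ i := le_of_max_le_right hi
  obtain ⟨hpti, hconei⟩ := hBi
  obtain ⟨hpti', hanisoi'⟩ := (arithBinaryResidueAt_iff R P s 2 d i').mp hAi'
  refine (arithBinaryResidueAt_iff R P s 2 d i).mpr ⟨hpti, ?_⟩
  -- ### (6) `d = d₀`; `i` is an A-stage of cleaned order `d`
  have hcli : HasCleanedOrderAt R s 2 i d := hasCleanedOrderAt_of_binaryConeE2At (hreg i) hd hconei
  obtain ⟨hdd₀, hnoi⟩ := eq_and_noOddDivisorAt_of_hasReducedOrderAt hd hd₀ hcli (hred i hi₁i hpti)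
  subst hdd₀
  have hAi : IsAStageAt R P s 2 i d := ⟨hpti, hnoi, hd, hcli⟩
  -- ### (7) the descending induction over the point steps of `[i, i′]`
  have h2d : 2 ≤ d := by omega
  have hmod1 : d % 2 = 1 := Nat.odd_iff.mp hd
  have hQ : ∀ j, i ≤ j → j ≤ i' → IsPointStep R P j →
      (IsAStageAt R P s 2 j d → BinaryConeE2At R s 2 d j → AnisotropicConeAt R s 2 d j) ∧
      (∀ x : K, IsBStageAt R P s 2 j x → BinaryBConeE2At R s 2 x d j → AnisotropicBConeAt R s 2 x d j) := by
    refine desc_pointSteps_of_visitPairs R P hrec _ hpti' ⟨fun _ _ => hanisoi', fun x hB _ => ?_⟩ ?_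
    · -- at `i′`: an A-stage (the anisotropic cone fixes the cleaned order `d`), so no B-part
      exfalso
      have hcl' : HasCleanedOrderAt R s 2 i' d := hasCleanedOrderAt_of_anisotropicConeAt (hreg i') hd hanisoi'
      obtain ⟨-, hno'⟩ := eq_and_noOddDivisorAt_of_hasReducedOrderAt hd hd hcl' (hred i' (hi₁i.trans hii') hpti')
      exact hno' x hB.2
    · intro j j' hij hj'i' hv hQj'
      have hN₂j : N₂ ≤ j := hN₂i.trans hij
      have hi₁j : i₁ ≤ j := hi₁i.trans hij
      have hjj' : j < j' := hv.1
      have hN₂j' : N₂ ≤ j' := hN₂j.trans hjj'.le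
      have hi₁j' : i₁ ≤ j' := hi₁j.trans hjj'.le
      have hi₂j' : i₂ ≤ j' := (hi₂i.trans hij).trans hjj'.le
      have h1j' := h1'' j' hN₂j' hv.2.2.1
      have hredj' : HasReducedOrderAt R s 2 j' d := hred j' hi₁j' hv.2.2.1
      refine ⟨fun hAj hconej => ?_, fun x hBj hconej => ?_⟩
      · -- A → B along the exceptional parameter `u := xx j`
        have hΓj := hΓ j j' (xx j) hN₂j hv (hxx j)
        obtain ⟨⟨hRj', -⟩, -, hclord⟩ := VisitLawDelta.visitLaw₂_of_run hrun hdom0 hv (hxx j) hΓj hreg h1j' h2d hAj.2.2.2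
        rw [hmod1] at hclord
        have hx1 : xx j ∈ R (j + 1) := (hbl j).isLocalBlowup.le (hxx j).1.fst
        obtain ⟨hxm, hx2, -⟩ :=
          VisitLawPointStep.prime_excParam_succ hrun hdom0 hv.2.1 (hreg j) (hreg (j + 1)) (hxx j) hx1
        have hoddu : IsOddDivisorAt R s 2 j' (xx j) := by
          have key : ∀ (S : Subring K) (hS : S = R (j + 1)) (hxS : xx j ∈ S) [IsLocalRing S],
              (⟨xx j, hxS⟩ : S) ∈ maximalIdeal S ∧ (⟨xx j, hxS⟩ : S) ∉ maximalIdeal S ^ 2 := by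
            intro S hS hxS _
            subst hS
            exact ⟨hxm, hx2⟩
          obtain ⟨hm, hm2⟩ := key (R j') hRj' (hRj' ▸ hx1)
          exact ⟨hRloc j', hRj' ▸ hx1, hm, hm2, 1, odd_one, hclord⟩
        have hBj' : IsBStageAt R P s 2 j' (xx j) := ⟨hv.2.2.1, hoddu⟩
        have hclj' : HasCleanedOrderAt R s 2 j' (d + 1) := hasCleanedOrderAt_succ_of_isOddDivisorAt hredj' hoddu
        have hBcone : BinaryBConeE2At R s 2 (xx j) d j' :=
          hFAB K O R P t s hrun hdom0 hreg hdim j j' (xx j) d hd h3 hv (hxx j) hΓj h1j' hAj hconej hclj'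
        have hBan : AnisotropicBConeAt R s 2 (xx j) d j' := hQj'.2 (xx j) hBj' hBcone
        exact hPAB K O R P t s hrun hdom0 hreg hdim j j' (xx j) d hd h3 hv (hxx j) hΓj h1j' hAj hconej hclj' hBan
      · -- at a B-stage along `x`: `x ∈ P j`, so `v x ≤ v u`
        have hclj : HasCleanedOrderAt R s 2 j (d + 1) :=
          hasCleanedOrderAt_succ_of_isOddDivisorAt (hred j hi₁j hv.2.1) hBj.2
        obtain ⟨_, hxR, hxm, hx2, -⟩ := hBj.2
        have hxP : (⟨x, hxR⟩ : R j) ∈ P j := by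
          obtain ⟨_, hPj⟩ := hv.2.1
          rw [hPj]
          exact hxm
        have hx0 : x ≠ 0 := by
          rintro rfl
          exact hx2 (by rw [show (⟨(0 : K), hxR⟩ : R j) = 0 from Subtype.ext rfl]; exact Ideal.zero_mem _)
        rcases ((hxx j).2.2 ⟨x, hxR⟩ hxP).lt_or_eq with hlt | heq
        · -- B → B: `x / u` is the odd divisor at `j′` (S-BB)
          have hΓj := hΓ j j' (xx j) hN₂j hv (hxx j)
          have hoddq : IsOddDivisorAt R s 2 j' (x / xx j) :=
            hSBB K O R P t s hrun hdom0 hreg hdim j j' x (xx j) d hd h3 hv (hxx j) hΓj h1j' hBj hclj hlt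
          have hBj' : IsBStageAt R P s 2 j' (x / xx j) := ⟨hv.2.2.1, hoddq⟩
          have hclj' : HasCleanedOrderAt R s 2 j' (d + 1) := hasCleanedOrderAt_succ_of_isOddDivisorAt hredj' hoddq
          have hBcone : BinaryBConeE2At R s 2 (x / xx j) d j' :=
            hFBB K O R P t s hrun hdom0 hreg hdim j j' x (xx j) d hd h3 hv (hxx j) hΓj h1j' hBj hclj hconej hlt hclj'
          have hBan : AnisotropicBConeAt R s 2 (x / xx j) d j' := hQj'.2 (x / xx j) hBj' hBcone
          exact hPBB K O R P t s hrun hdom0 hreg hdim j j' x (xx j) d hd h3 hv (hxx j) hΓj h1j' hBj hclj hconej hlt hclj' hBan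
        · -- the RETURN: `x` is itself exceptional, the landing stage is an A-stage of order `d` (T-R)
          have hxexc : (∃ hx : x ∈ R j, (⟨x, hx⟩ : R j) ∈ P j) ∧ x ≠ 0 ∧
              ∀ y : R j, y ∈ P j → O.valuation (y : K) ≤ O.valuation x :=
            ⟨⟨hxR, hxP⟩, hx0, fun y hy => heq ▸ (hxx j).2.2 y hy⟩
          have hΓj := hΓ j j' x hN₂j hv hxexc
          have hAj' : IsAStageAt R P s 2 j' d :=
            hTR K O R P t s hrun hdom0 hreg hdim j j' x d hd h3 hv hxexc hΓj h1j' hBj hclj hconej hredj'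
          have hOj' : Words.OddCleanedPointStepAt R P s 2 j' := by
            obtain ⟨hlocj', hsj', hexj', hexactj'⟩ := hAj'.2.2.2
            exact ⟨hAj'.1, hlocj', hsj', d, hd, hexj', hexactj'⟩
          obtain ⟨-, hconej'⟩ := hTC j' hi₂j' hOj'
          have hAn' : AnisotropicConeAt R s 2 d j' := hQj'.1 hAj' hconej'
          exact hPBA K O R P t s hrun hdom0 hreg hdim j j' x d hd h3 hv hxexc hΓj h1j' hBj hclj hconej hAj' hAn'
  -- ### (8) conclude at the A-stage `i`
  exact (hQ i le_rfl hii' hpti).1 hAi hconei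

end Summit.ResolutionOfSingularities.ResolutionOfSingularities.Theorems.SwitchingDichotomy.ArithTransport
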